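import Literature.NumberTheory.EllipticCurves.SzpiroLocalDataProofs
import Literature.NumberTheory.DiophantineGeometry.LocalReductionHasMultiplicativeReductionAtProofs
import HarnessLib

/-!
# Stub `stub_splitAtT` (line `SketchIdeator2`, crux `MobiusLadder.LiouvilleNotPPoly`)

Tate's algorithm for the `X₁(3)` family `E_t : y² + x·y + t·y = x³` (`a₁ = 1`, `a₃ = t`,
`a₂ = a₄ = a₆ = 0`; `b₂ = 1`, `b₄ = t`, `b₆ = t²`, `c₄ = 1 − 24t`, `Δ = t³(1 − 27t)`) at a prime
`p ∣ t` (`t ≥ 1`): the equation is `p`-integral with unit `c₄` (as `p ∤ 1 − 24t`), hence it is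
minimal at `p` with multiplicative reduction (`p ∣ t ∣ Δ`); the node-tangent polynomial of
Mathlib's `HasSplitMultiplicativeReduction`,
`c₄ T² + a₁ c₄ T − (54 b₆ − 3 b₂ b₄ + a₂ c₄) = (1 − 24t) T² + (1 − 24t) T − t (54t − 3)`,
reduces to `T² + T = T (T + 1)` modulo `p`, which splits: **split multiplicative reduction**.
Split-ness is transferred from this minimal equation to Mathlib's chosen local minimal model
(`WeierstrassCurve.localMinimalModel`) by
`WeierstrassCurve.hasSplitMultiplicativeReduction_iff_of_isMinimal_of_eq_smul`
(Silverman, *AEC*, VII.1 Prop. 1.3(b), VII.5 Prop. 5.1(b)). Template: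
`Literature.NumberTheory.EllipticCurves.KramerCurvesPadic` (same node polynomial `T² + T`).
-/

set_option linter.dupNamespace false -- D-0017: single-problem summit ⇒ QuantumAdvantage.QuantumAdvantage by design

noncomputable section

open scoped Classical

namespace Summit.QuantumAdvantage.QuantumAdvantage.Theorems.LiouvilleNotPPoly

open IsDedekindDomain IsLocalRing Polynomial WeierstrassCurve

/-! ### The equation `y² + xy + s·y = x³` over a commutative ring: invariants -/

/-- `c₄ = 1 − 24 s` for `y² + xy + s y = x³`. [folklore] -/
theorem hesse_c₄ {S : Type*} [CommRing S] (s : S) :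
    ({ a₁ := 1, a₂ := 0, a₃ := s, a₄ := 0, a₆ := 0 } : WeierstrassCurve S).c₄ = 1 - 24 * s := by
  simp only [WeierstrassCurve.c₄, WeierstrassCurve.b₂, WeierstrassCurve.b₄]
  ring

/-- `Δ = s³ (1 − 27 s)` for `y² + xy + s y = x³`. [folklore] -/
theorem hesse_Δ {S : Type*} [CommRing S] (s : S) :
    ({ a₁ := 1, a₂ := 0, a₃ := s, a₄ := 0, a₆ := 0 } : WeierstrassCurve S).Δ =
      s ^ 3 * (1 - 27 * s) := by
  simp only [WeierstrassCurve.Δ, WeierstrassCurve.b₂, WeierstrassCurve.b₄, WeierstrassCurve.b₆,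
    WeierstrassCurve.b₈]
  ring

/-- The constant term `54 b₆ − 3 b₂ b₄ + a₂ c₄ = s (54 s − 3)` of the node-tangent polynomial of
`y² + xy + s y = x³`. [folklore] -/
theorem hesse_nodal_const {S : Type*} [CommRing S] (s : S) :
    letI I : WeierstrassCurve S := { a₁ := 1, a₂ := 0, a₃ := s, a₄ := 0, a₆ := 0 }
    54 * I.b₆ - 3 * I.b₂ * I.b₄ + I.a₂ * I.c₄ = s * (54 * s - 3) := by
  simp only [WeierstrassCurve.c₄, WeierstrassCurve.b₂, WeierstrassCurve.b₄, WeierstrassCurve.b₆]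
  ring

/-- The node-tangent polynomial of `y² + xy + s y = x³` reduces to `T² + T` modulo any ideal
containing `s` (here: along a ring map `f` with `f s = 0`). [folklore] -/
theorem hesse_nodalTangents_map {S F : Type*} [CommRing S] [CommRing F] (f : S →+* F) (s : S)
    (hs : f s = 0) :
    letI I : WeierstrassCurve S := { a₁ := 1, a₂ := 0, a₃ := s, a₄ := 0, a₆ := 0 }
    Polynomial.map f
      (C I.c₄ * X ^ 2 + C (I.a₁ * I.c₄) * X - C (54 * I.b₆ - 3 * I.b₂ * I.b₄ + I.a₂ * I.c₄)) =
      X ^ 2 + X := by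
  have e1 : f ({ a₁ := 1, a₂ := 0, a₃ := s, a₄ := 0, a₆ := 0 } : WeierstrassCurve S).c₄ = 1 := by
    rw [hesse_c₄, map_sub, map_one, map_mul, hs, mul_zero, sub_zero]
  have e3 := hesse_nodal_const s
  simp only at e3
  simp only
  rw [e3, Polynomial.map_sub, Polynomial.map_add, Polynomial.map_mul, Polynomial.map_mul,
    Polynomial.map_pow, Polynomial.map_C, Polynomial.map_C, Polynomial.map_C, Polynomial.map_X,
    one_mul, e1, map_mul, hs, zero_mul, map_one, map_zero, one_mul, one_mul, sub_zero]

/-! ### The stub -/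

open Rat.HeightOneSpectrum in
/-- **STUB C1 · `stub_splitAtT`.** For `t ≥ 1` and a prime `p ∣ t` (the place `v` of `ℤ` with
`natGenerator v = p`), the curve `E_t : y² + xy + t y = x³` has split multiplicative reduction at
`v`: the equation is `v`-integral with `v (c₄) = v (1 − 24t) = 1`, `v (Δ) = v (t³(1 − 27t)) < 1`,
hence minimal and multiplicative at `v`, and its node-tangent polynomial reduces to
`T (T + 1)`, which splits; this passes to the chosen local minimal model by
`hasSplitMultiplicativeReduction_iff_of_isMinimal_of_eq_smul`. Silverman, *AEC*, VII.1
Remark 1.1 and Prop. 1.3(b), VII.5 Prop. 5.1(b). -/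
theorem stub_splitAtT :
    ∀ t : ℕ, 1 ≤ t → ∀ v : HeightOneSpectrum ℤ, Rat.HeightOneSpectrum.natGenerator v ∣ t →
    ({ a₁ := 1, a₂ := 0, a₃ := (t : ℚ), a₄ := 0, a₆ := 0 } : WeierstrassCurve ℚ).HasSplitMultiplicativeReductionAt v := by
  intro t ht v hp
  set W : WeierstrassCurve ℚ := { a₁ := 1, a₂ := 0, a₃ := (t : ℚ), a₄ := 0, a₆ := 0 } with hW
  -- divisibilities in `ℤ`
  have hp' : (natGenerator v : ℤ) ∣ (t : ℤ) := Int.natCast_dvd_natCast.mpr hp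
  have hpp : (natGenerator v).Prime := prime_natGenerator v
  have hc₄int : ¬ (natGenerator v : ℤ) ∣ 1 - 24 * (t : ℤ) := by
    intro h
    have h1 : (natGenerator v : ℤ) ∣ 1 := by
      have h2 := h.add (hp'.mul_left 24)
      rwa [sub_add_cancel] at h2
    have h3 : (natGenerator v : ℤ) = 1 := Int.eq_one_of_dvd_one (by positivity) h1
    exact hpp.one_lt.ne' (by exact_mod_cast h3)
  have hΔint : (natGenerator v : ℤ) ∣ (t : ℤ) ^ 3 * (1 - 27 * (t : ℤ)) :=
    (dvd_pow hp' three_ne_zero).mul_right _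
  -- valuations over `ℚ`
  have hc₄ : v.valuation ℚ W.c₄ = 1 := by
    rw [hW, hesse_c₄, show (1 - 24 * (t : ℚ)) = ((1 - 24 * (t : ℤ) : ℤ) : ℚ) by push_cast; ring]
    exact (Literature.NumberTheory.EllipticCurves.Rat.valuation_intCast_eq_one_iff v _).mpr hc₄int
  have hΔ : v.valuation ℚ W.Δ < 1 := by
    rw [hW, hesse_Δ, show (t : ℚ) ^ 3 * (1 - 27 * (t : ℚ)) =
      (((t : ℤ) ^ 3 * (1 - 27 * (t : ℤ)) : ℤ) : ℚ) by push_cast; ring]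
    exact (Literature.NumberTheory.EllipticCurves.Rat.valuation_intCast_lt_one_iff v _).mpr hΔint
  have ht1 : v.valuation ℚ (t : ℚ) < 1 := by
    rw [show ((t : ℚ)) = ((t : ℤ) : ℚ) from (Int.cast_natCast t).symm]
    exact (Literature.NumberTheory.EllipticCurves.Rat.valuation_intCast_lt_one_iff v _).mpr hp'
  have hΔ0 : W.Δ ≠ 0 := by
    rw [hW, hesse_Δ]
    have h1 : (t : ℚ) ≠ 0 := by exact_mod_cast (by omega : t ≠ 0)
    have h2 : (1 - 27 * (t : ℚ)) ≠ 0 := by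
      have h3 : (27 : ℚ) ≤ 27 * (t : ℚ) := by exact_mod_cast (by omega : 27 ≤ 27 * t)
      intro h
      linarith
    exact mul_ne_zero (pow_ne_zero _ h1) h2
  haveI hE : W.IsElliptic := ⟨by rw [isUnit_iff_ne_zero]; exact hΔ0⟩
  -- the local objects at `v`
  set O := v.adicCompletionIntegers ℚ with hO
  set Xv := W.baseChange (v.adicCompletion ℚ) with hX
  set I₀ : WeierstrassCurve O := { a₁ := 1, a₂ := 0, a₃ := (t : O), a₄ := 0, a₆ := 0 } with hI₀
  have hXI : Xv = I₀.baseChange (v.adicCompletion ℚ) := by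
    rw [hX, hI₀, hW]
    ext <;> simp [WeierstrassCurve.baseChange, WeierstrassCurve.map]
  haveI hint : Xv.IsIntegral O := ⟨⟨I₀, hXI⟩⟩
  have hWint : W.IsIntegralAt v := hint
  haveI hmin : Xv.IsMinimal O := isMinimalAt_of_valuation_c₄_eq_one hWint hc₄
  -- Mathlib's chosen integral model of `X` is `I₀`
  have hIM : Xv.integralModel O = I₀ := by
    apply WeierstrassCurve.map_injective (f := algebraMap O (v.adicCompletion ℚ))
      (IsFractionRing.injective _ _)
    change (Xv.integralModel O).baseChange (v.adicCompletion ℚ) = I₀.baseChange (v.adicCompletion ℚ)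
    rw [baseChange_integralModel_eq, hXI]
  -- `t ∈ 𝔪 (O_v)`
  have htm : (t : O) ∈ maximalIdeal O := by
    have h2 : (IsDiscreteValuationRing.maximalIdeal O).valuation (v.adicCompletion ℚ)
        (algebraMap ℚ (v.adicCompletion ℚ) (t : ℚ)) < 1 :=
      (valuation_maximalIdeal_adicCompletion_lt_one_iff v (t : ℚ)).mpr ht1
    rw [map_natCast, ← map_natCast (algebraMap O (v.adicCompletion ℚ)) t,
      HeightOneSpectrum.valuation_lt_one_iff_mem] at h2
    exact h2
  -- multiplicative reduction of the (minimal) equation `X`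
  have hmult : Xv.HasMultiplicativeReduction O := by
    rw [hasMultiplicativeReduction_iff]
    refine ⟨hmin, ?_, ?_⟩
    · rw [hX, WeierstrassCurve.baseChange, map_Δ]
      exact (valuation_maximalIdeal_adicCompletion_lt_one_iff v W.Δ).mpr hΔ
    · rw [hX, WeierstrassCurve.baseChange, map_c₄]
      exact (valuation_maximalIdeal_adicCompletion_eq_one_iff v W.c₄).mpr hc₄
  -- split multiplicative reduction of `X`: the node polynomial reduces to `T (T + 1)`
  have hsplit : Xv.HasSplitMultiplicativeReduction O := by
    haveI := hmult
    refine ⟨?_⟩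
    rw [hIM]
    change Splits (Polynomial.map (algebraMap O (ResidueField O)) _)
    have hs : algebraMap O (ResidueField O) (t : O) = 0 := by
      rw [IsLocalRing.ResidueField.algebraMap_eq, residue_eq_zero_iff]
      exact htm
    have key := hesse_nodalTangents_map (algebraMap O (ResidueField O)) (t : O) hs
    simp only at key
    rw [hI₀, key, show (X ^ 2 + X : (ResidueField O)[X]) = X * (X + C 1) by rw [map_one]; ring]
    exact Splits.X.mul (Splits.X_add_C 1)
  -- transfer to Mathlib's chosen local minimal model `E • X`
  obtain ⟨E, hE'⟩ : ∃ E : VariableChange (v.adicCompletion ℚ), W.localMinimalModel v = E • Xv :=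
    ⟨_, rfl⟩
  have hΔX : Xv.Δ ≠ 0 := by
    rw [hX, WeierstrassCurve.baseChange, map_Δ]
    exact (_root_.map_ne_zero _).mpr hΔ0
  unfold HasSplitMultiplicativeReductionAt
  exact (hasSplitMultiplicativeReduction_iff_of_isMinimal_of_eq_smul O hE' hΔX).mpr hsplit

end Summit.QuantumAdvantage.QuantumAdvantage.Theorems.LiouvilleNotPPoly

end
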